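import Literature.NumberTheory.EllipticCurves.JetchevSkinnerWan2017.SigmaLocalFinitelyDecomposedFiniteProofs
import Literature.NumberTheory.EllipticCurves.BigRepLocalTermCofinitelyGeneratedProofs
import Literature.NumberTheory.EllipticCurves.InertiaCohomologyPrimaryTorsionFiniteProofs
import Literature.NumberTheory.EllipticCurves.SkinnerUrban2014.CofinitelyGeneratedSelmerProofs
import HarnessLib

/-!
# The local `Σ`-atom at EVERY finitely decomposed place `w ∤ p` (`c ≠ 0`): the Pontryagin dual of
# `H¹(K_w, T_pE ⊗ Λ^*(Ψ⁻¹))` is finitely generated and torsion over `Λ` — UNCONDITIONALLY — and its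
# characteristic ideal contains the intrinsic Euler factor `P_w((1+T)^{−c})`

Topic `Literature/NumberTheory/EllipticCurves/JetchevSkinnerWan2017` (sibling of the named LOCAL fact
`sigmaLocal_charIdeal_eulerFactor_mem_of_noTamagawaDefect`). THEOREMS ONLY (no definition, no named fact,
no `sorry`). Cell `bsd-stepL`, K2 support 20495 `JSWSigmaLocalCharIdeal`, module L5; seat `bsd-stepL-imc-p1` g13.

For `E` elliptic over a number field `K : Type`, a prime `p`, a `ℤ_p`-extension `κ`, a finite place `w ∤ p`,
an arithmetic Frobenius `φ ∈ Γ_{K_w}` with `κ(φ) = c ≠ 0` (`w` finitely decomposed in `K_∞`):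

* `sigmaLocal_dual_of_ne_zero` — **`X_w = H¹(K_w, T_pE ⊗ Λ^*(Ψ⁻¹))^∨` is finitely generated and torsion over
  `Λ`, and `P((1+T)^{−c}) ∈ Ch_Λ(X_w)` where `P = (charpoly Lt).reverse` for any endomorphism `Lt` of
  `Y = H¹(I_w, E[p^∞])^∨ ⧸ tors` induced by the dual of the conjugation action of `φ`** (the intrinsic
  `P_w(X) = det(1 − X·Frob_w | Y)` of [GreenbergVatsal2000] Prop. 2.4);
* `sigmaLocal_moduleFinite_isTorsion_of_ne_zero` — **conjuncts (1) and (2) of the atom at every finitely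
  decomposed place, from the Euler datum alone** (`IsEulerDataAt E κ w Nw t c`, `c ≠ 0`), for every
  reduction type.

Inputs: the general local term `BigGaloisRep.moduleFinite_isTorsion_mem_charIdeal_dual_h1_bigRep_of_cofinitelyGenerated`
(`BigRepLocalTermCofinitelyGeneratedProofs`) and the two arithmetic facts making its coefficient modules
cofinitely generated at `w ∤ p`: `E[p^∞]^{I_w}[p] ⊆ E[p]` finite, and `H¹(I_w, E[p^∞])[p]` finite
(`finite_torsionBy_continuousCohomology_one_absInertia`, Serre *Local Fields* IV §2 ∕ XIII §1), via
topological Nakayama `SkinnerUrban2014.module_finite_characterModule_of_torsion_finite`.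

HONEST FRAMING: conjunct (3) of the atom (`eulerFactor p ℤ_[p] Nw t c ∈ Ch_Λ(X_w)`) is proved here in
the INTRINSIC form only; the identification `P((1+T)^{−c}) = unit · eulerFactor p ℤ_[p] Nw t c` for the good
and multiplicative reduction data (`Y ≅ T_p(E)(−1)^*`, resp. the toric line; Frobenius eigenvalues
`α/q, β/q`, resp. `±1/q`) is NOT in this file. (It holds at the additive places trivially and is not needed
at `c = 0`.)

References: [GreenbergVatsal2000] Prop. 2.4 and proof (arXiv pp. 21–23); [GreenbergLNM1716] §3;
[Skinner2016PacificMC] §2.3 (p. 180); [SerreLocalFields1979] IV §2, XIII §1; [Washington1997] §13.2.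
-/

noncomputable section

open scoped Classical Pointwise

open Field NumberField IsDedekindDomain WeierstrassCurve Multiplicative
open Literature.NumberTheory.EllipticCurves Literature.NumberTheory.GaloisRepresentations
  Literature.NumberTheory.EllipticCurves.BigGaloisRep Literature.NumberTheory.EllipticCurves.IwasawaCharacter

namespace Literature.NumberTheory.EllipticCurves.JetchevSkinnerWan2017

/-- **`E[p^∞]^{I_w}` is cofinitely generated** (`w ∤ p`): its `p`-torsion lies in `E[p]`.
[cite: GreenbergLNM1716, §3 (B_v ≅ (ℚ_p/ℤ_p)^e × finite)] [cite: SilvermanAEC2009, Cor. III.6.4] -/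
theorem moduleFinite_characterModule_invariantsOf_primaryTorsion {K : Type} [Field K] [NumberField K]
    (E : WeierstrassCurve K) [E.IsElliptic] (p : ℕ) [Fact p.Prime] (w : HeightOneSpectrum (𝓞 K))
    [ContinuousSMul ℤ_[p] (PrimaryTorsion (geomPoints E) p)]
    (N : Subgroup (absoluteGaloisGroup (w.adicCompletion K))) :
    Module.Finite ℤ_[p] (CharacterModule
      ((((E.primaryTorsionGaloisRep p).restrict (localMap K (Sum.inl w)) :
        ContinuousRep (absoluteGaloisGroup (w.adicCompletion K)) ℤ_[p]
          (PrimaryTorsion (geomPoints E) p))).invariantsOf N)) := by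
  set ρw : ContinuousRep (absoluteGaloisGroup (w.adicCompletion K)) ℤ_[p] (PrimaryTorsion (geomPoints E) p) :=
    (E.primaryTorsionGaloisRep p).restrict (localMap K (Sum.inl w)) with hρw
  refine SkinnerUrban2014.module_finite_characterModule_of_torsion_finite (fun d => ?_) ?_
  · obtain ⟨k, hk⟩ := (d.1 : PrimaryTorsion (geomPoints E) p).exists_pow_smul_eq_zero
    refine ⟨k, Subtype.ext ?_⟩
    rw [Submodule.coe_smul, Submodule.coe_zero, ← Nat.cast_pow, PrimaryTorsion.natCast_smul]
    exact PrimaryTorsion.ext (by rw [PrimaryTorsion.val_nsmul, hk, PrimaryTorsion.val_zero])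
  · haveI : Finite (geomTorsion E (p : ℤ)) := finite_geomTorsion_natCast E (Fact.out : p.Prime).ne_zero
    haveI : Finite {d : ρw.invariantsOf N | (p : ℤ_[p]) • d = 0} := by
      refine Finite.of_injective (fun d : {d : ρw.invariantsOf N | (p : ℤ_[p]) • d = 0} =>
        (⟨((d.1.1 : PrimaryTorsion (geomPoints E) p) : geomPoints E), by
          rw [mem_geomTorsion_iff, natCast_zsmul]
          have h := congrArg (fun x : ρw.invariantsOf N => ((x : PrimaryTorsion (geomPoints E) p) :
            geomPoints E)) d.2
          simpa only [Submodule.coe_smul, PrimaryTorsion.natCast_smul, PrimaryTorsion.val_nsmul,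
            Submodule.coe_zero, PrimaryTorsion.val_zero] using h⟩ : geomTorsion E (p : ℤ))) ?_
      intro a b hab
      have h1 := Subtype.ext_iff.mp hab
      exact Subtype.ext (Subtype.ext (PrimaryTorsion.ext h1))
    exact Set.toFinite _

/-- **`H¹(I_w, E[p^∞])` is cofinitely generated** (`w ∤ p`): it is `p`-primary (compact `I_w`, discrete
torsion coefficients) and its `p`-torsion is finite (`#H¹(I_w, A)[p] ≤ #A[p]^{I_w}`, Serre *Local Fields*
IV §2 ∕ XIII §1, Milne *ADT* I 2.9), in the `ℤ_p`-typed `subgroupRep` currency (scalars do not matter: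
`continuousCohomologyAddEquiv`). [cite: SerreLocalFields1979, Ch. IV §2 and Ch. XIII §1 Prop. 1]
[cite: MilneADT2006, I §2 Lemma 2.9] [cite: GreenbergLNM1716, §3] -/
theorem moduleFinite_characterModule_h1_absInertia_primaryTorsion {K : Type} [Field K] [NumberField K]
    (E : WeierstrassCurve K) [E.IsElliptic] (p : ℕ) [Fact p.Prime] (w : HeightOneSpectrum (𝓞 K))
    (hw : ((p : ℕ) : 𝓞 K) ∉ w.asIdeal) [ContinuousSMul ℤ_[p] (PrimaryTorsion (geomPoints E) p)] :
    Module.Finite ℤ_[p] (CharacterModule (continuousCohomology 1 (subgroupRep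
      (((E.primaryTorsionGaloisRep p).restrict (localMap K (Sum.inl w)) :
        ContinuousRep (absoluteGaloisGroup (w.adicCompletion K)) ℤ_[p]
          (PrimaryTorsion (geomPoints E) p))).toTopRep
        (absInertia (w.adicCompletion K))))) := by
  haveI : CompactSpace (absoluteGaloisGroup (w.adicCompletion K)) :=
    absoluteGaloisGroup_compactSpace (w.adicCompletion K)
  haveI : CompactSpace (absInertia (w.adicCompletion K)) :=
    isCompact_iff_compactSpace.mp (isClosed_absInertia_holds (w.adicCompletion K)).isCompact
  set ρw : ContinuousRep (absoluteGaloisGroup (w.adicCompletion K)) ℤ_[p] (PrimaryTorsion (geomPoints E) p) :=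
    (E.primaryTorsionGaloisRep p).restrict (localMap K (Sum.inl w)) with hρw
  set ρZ : ContinuousRep (absoluteGaloisGroup (w.adicCompletion K)) ℤ (PrimaryTorsion (geomPoints E) p) :=
    ρw.restrictScalars ℤ with hρZ
  set H := continuousCohomology 1 (subgroupRep ρw.toTopRep (absInertia (w.adicCompletion K))) with hH
  have hA : ∀ a : PrimaryTorsion (geomPoints E) p, ∃ k : ℕ, (p : ℤ_[p]) ^ k • a = 0 := fun a =>
    (a.exists_pow_smul_eq_zero).imp fun k hk => by
      rw [← Nat.cast_pow, PrimaryTorsion.natCast_smul]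
      exact PrimaryTorsion.ext (by rw [PrimaryTorsion.val_nsmul, hk, PrimaryTorsion.val_zero])
  refine SkinnerUrban2014.module_finite_characterModule_of_torsion_finite
    (fun y => BigGaloisRep.exists_pow_smul_eq_zero _ (p : ℤ_[p]) hA y) ?_
  -- `H¹(I_w, A)[p]` is finite: the `ℤ`-typed bound, transported
  have hcop := Nat.Coprime.pow_left 1 ((Nat.coprime_primes (Fact.out : p.Prime)
      (ringChar_residueField_prime (F := w.adicCompletion K))).mpr
        (Ne.symm (w.ringChar_residueField_adicCompletion_ne hw)))
  haveI := E.finite_torsionBy_int_primaryTorsion p 1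
  haveI hZ := finite_torsionBy_continuousCohomology_one_absInertia (w.adicCompletion K) ρZ hcop
    (fun a => E.exists_prime_pow_nsmul_eq_primaryTorsion p 1 a)
  let η : PrimaryTorsion (geomPoints E) p ≃ₜ+ PrimaryTorsion (geomPoints E) p :=
    ContinuousAddEquiv.refl _
  have hη : ∀ (g : absInertia (w.adicCompletion K)) (x : PrimaryTorsion (geomPoints E) p),
      η ((ρZ.restrict (Literature.NumberTheory.GaloisRepresentations.subgroupIncl
          (absInertia (w.adicCompletion K)))).toTopRep.ρ g x) =
        (subgroupRep ρw.toTopRep (absInertia (w.adicCompletion K))).ρ g (η x) :=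
    fun _ _ => rfl
  let e := continuousCohomologyAddEquiv
    (X := (ρZ.restrict (Literature.NumberTheory.GaloisRepresentations.subgroupIncl
      (absInertia (w.adicCompletion K)))).toTopRep)
    (Y := subgroupRep ρw.toTopRep (absInertia (w.adicCompletion K))) η hη 1
  haveI : Finite {y : H | (p : ℤ_[p]) • y = 0} := by
    refine Finite.of_injective (fun y : {y : H | (p : ℤ_[p]) • y = 0} =>
      (⟨e.symm y.1, by
        rw [Submodule.mem_torsionBy_iff, Nat.cast_smul_eq_nsmul, ← map_nsmul, pow_one]
        have hy : (p : ℤ_[p]) • (y.1 : H) = 0 := y.2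
        rw [Nat.cast_smul_eq_nsmul] at hy
        rw [hy, map_zero]⟩ : Submodule.torsionBy ℤ (continuousCohomology 1
          ((ρZ.restrict (Literature.NumberTheory.GaloisRepresentations.subgroupIncl
            (absInertia (w.adicCompletion K)))).toTopRep)) ((p ^ 1 : ℕ) : ℤ))) ?_
    intro a b hab
    have h1 := Subtype.ext_iff.mp hab
    exact Subtype.ext (e.symm.injective h1)
  exact Set.toFinite _

/-- **The local `Σ`-atom at a finitely decomposed place, general reduction type, intrinsic Euler factor.**
`X_w = H¹(K_w, T_pE ⊗ Λ^*(Ψ⁻¹))^∨` is finitely generated and torsion over `Λ`, and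
`(charpoly Lt).reverse((1+T)^{−c}) ∈ Ch_Λ(X_w)` for the endomorphism `Lt` of `H¹(I_w, E[p^∞])^∨ ⧸ tors`
induced by the dual of the conjugation action of the Frobenius `φ`, `κ(φ) = c ≠ 0`.
[cite: GreenbergVatsal2000, Prop. 2.4 and proof (arXiv pp. 21–23)] [cite: Skinner2016PacificMC, §2.3 (p. 180)]
[cite: GreenbergLNM1716, §3 (proof of Lemma 3.3)] -/
theorem sigmaLocal_dual_of_ne_zero {K : Type} [Field K] [NumberField K]
    (E : WeierstrassCurve K) [E.IsElliptic] (p : ℕ) [Fact p.Prime] (κ : ZpExtension K p)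
    (w : HeightOneSpectrum (𝓞 K)) (hw : ((p : ℕ) : 𝓞 K) ∉ w.asIdeal)
    {φ : absoluteGaloisGroup (w.adicCompletion K)} (hφ : IsFrobPow φ 1) {c : ℤ_[p]}
    (hκφ : κ (localMap K (Sum.inl w) φ) = Multiplicative.ofAdd c) (hc : c ≠ 0)
    [ContinuousSMul ℤ_[p] (PrimaryTorsion (geomPoints E) p)]
    [TopologicalSpace (IwasawaAlgebra p)]
    [ContinuousSMul (IwasawaAlgebra p) (BigRepModule ℤ_[p] p (PrimaryTorsion (geomPoints E) p))]
    [Module.Finite ℤ_[p] (CharacterModule (continuousCohomology 1 (subgroupRep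
        (((E.primaryTorsionGaloisRep p).restrict (localMap K (Sum.inl w)) :
          ContinuousRep (absoluteGaloisGroup (w.adicCompletion K)) ℤ_[p]
            (PrimaryTorsion (geomPoints E) p))).toTopRep (absInertia (w.adicCompletion K)))))]
    (Lt : (CharacterModule (continuousCohomology 1 (subgroupRep
        (((E.primaryTorsionGaloisRep p).restrict (localMap K (Sum.inl w)) :
          ContinuousRep (absoluteGaloisGroup (w.adicCompletion K)) ℤ_[p]
            (PrimaryTorsion (geomPoints E) p))).toTopRep (absInertia (w.adicCompletion K)))) ⧸
        Submodule.torsion ℤ_[p] (CharacterModule (continuousCohomology 1 (subgroupRep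
          (((E.primaryTorsionGaloisRep p).restrict (localMap K (Sum.inl w)) :
            ContinuousRep (absoluteGaloisGroup (w.adicCompletion K)) ℤ_[p]
              (PrimaryTorsion (geomPoints E) p))).toTopRep (absInertia (w.adicCompletion K)))))) →ₗ[ℤ_[p]]
      (CharacterModule (continuousCohomology 1 (subgroupRep
        (((E.primaryTorsionGaloisRep p).restrict (localMap K (Sum.inl w)) :
          ContinuousRep (absoluteGaloisGroup (w.adicCompletion K)) ℤ_[p]
            (PrimaryTorsion (geomPoints E) p))).toTopRep (absInertia (w.adicCompletion K)))) ⧸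
        Submodule.torsion ℤ_[p] (CharacterModule (continuousCohomology 1 (subgroupRep
          (((E.primaryTorsionGaloisRep p).restrict (localMap K (Sum.inl w)) :
            ContinuousRep (absoluteGaloisGroup (w.adicCompletion K)) ℤ_[p]
              (PrimaryTorsion (geomPoints E) p))).toTopRep (absInertia (w.adicCompletion K)))))))
    (hLt : ∀ χ, Lt (Submodule.Quotient.mk χ) = Submodule.Quotient.mk
      (CharacterModule.dual (conjMap (((E.primaryTorsionGaloisRep p).restrict (localMap K (Sum.inl w)) :
          ContinuousRep (absoluteGaloisGroup (w.adicCompletion K)) ℤ_[p]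
            (PrimaryTorsion (geomPoints E) p))).toTopRep (absInertia (w.adicCompletion K)) φ 1).hom.toLinearMap χ)) :
    Module.Finite (IwasawaAlgebra p) (CharacterModule (continuousCohomology 1
        ((AnticyclotomicBigGaloisRep κ (E.primaryTorsionGaloisRep p)).restrict
          (localMap K (Sum.inl w))).toTopRep)) ∧
      Module.IsTorsion (IwasawaAlgebra p) (CharacterModule (continuousCohomology 1
        ((AnticyclotomicBigGaloisRep κ (E.primaryTorsionGaloisRep p)).restrict
          (localMap K (Sum.inl w))).toTopRep)) ∧
      Polynomial.aeval (BigRepModule.binomSeries ℤ_[p] (-c)) (LinearMap.charpoly Lt).reverse ∈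
        Module.charIdeal (IwasawaAlgebra p) (CharacterModule (continuousCohomology 1
          ((AnticyclotomicBigGaloisRep κ (E.primaryTorsionGaloisRep p)).restrict
            (localMap K (Sum.inl w))).toTopRep)) := by
  haveI : CompactSpace (absoluteGaloisGroup (w.adicCompletion K)) :=
    absoluteGaloisGroup_compactSpace (w.adicCompletion K)
  haveI : CompactSpace (LocalGroup K (Sum.inl w)) := absoluteGaloisGroup_compactSpace (w.adicCompletion K)
  haveI hnormal : (absInertia (w.adicCompletion K)).Normal := absInertia_normal_holds (w.adicCompletion K)
  haveI : CompactSpace (absInertia (w.adicCompletion K)) :=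
    isCompact_iff_compactSpace.mp (isClosed_absInertia_holds (w.adicCompletion K)).isCompact
  set κw : absoluteGaloisGroup (w.adicCompletion K) →ₜ* Multiplicative ℤ_[p] :=
    κ.toContinuousMonoidHom.comp (localMap K (Sum.inl w)) with hκw
  have hκwφ : (κw φ).toAdd = c := by
    change (κ (localMap K (Sum.inl w) φ)).toAdd = c
    rw [hκφ]; rfl
  have hψ : (κw φ).toAdd ≠ 0 := by rw [hκwφ]; exact hc
  have hdense : Dense (((absInertia (w.adicCompletion K)) :
      Set (absoluteGaloisGroup (w.adicCompletion K))) *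
        (Subgroup.zpowers φ : Set (absoluteGaloisGroup (w.adicCompletion K)))) :=
    Literature.GroupTheory.dense_mul_zpowers_of_dense _ φ
      (dense_zpowers_mk_absInertia_of_isFrobPow (w.adicCompletion K) hφ)
  have hκN : ∀ n ∈ absInertia (w.adicCompletion K), κw n = 1 := fun n hn =>
    apply_eq_one_of_mem_absInertia (w.ringChar_residueField_adicCompletion_ne hw) κw hn
  have hA : ∀ a : PrimaryTorsion (geomPoints E) p, ∃ k : ℕ, p ^ k • a = 0 := fun a =>
    (a.exists_pow_smul_eq_zero).imp fun k hk =>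
      PrimaryTorsion.ext (by rw [PrimaryTorsion.val_nsmul, hk, PrimaryTorsion.val_zero])
  haveI := moduleFinite_characterModule_invariantsOf_primaryTorsion E p w (absInertia (w.adicCompletion K))
  obtain ⟨hfg, htors, hCh⟩ :=
    moduleFinite_isTorsion_mem_charIdeal_dual_h1_bigRep_of_cofinitelyGenerated κw
      ((E.primaryTorsionGaloisRep p).restrict (localMap K (Sum.inl w)) :
        ContinuousRep (absoluteGaloisGroup (w.adicCompletion K)) ℤ_[p] (PrimaryTorsion (geomPoints E) p))
      (absInertia (w.adicCompletion K)) hκN hψ hdense hA Lt hLt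
  rw [hκwφ] at hCh
  rw [show (AnticyclotomicBigGaloisRep κ (E.primaryTorsionGaloisRep p)).restrict (localMap K (Sum.inl w)) =
      bigRep κw ((E.primaryTorsionGaloisRep p).restrict (localMap K (Sum.inl w)) :
        ContinuousRep (absoluteGaloisGroup (w.adicCompletion K)) ℤ_[p] (PrimaryTorsion (geomPoints E) p))
      from bigRep_restrict _ _ _]
  exact ⟨hfg, htors, hCh⟩

/-- **Conjuncts (1) and (2) of the local `Σ`-atom at every finitely decomposed place, unconditionally.**
For `E` elliptic over a number field `K : Type`, `p` prime, `κ` a `ℤ_p`-extension, `w ∤ p` with Euler datum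
`(Nw, t, c)`, `c ≠ 0`: the Pontryagin dual of `H¹(K_w, T_pE ⊗ Λ^*(Ψ⁻¹))` is a finitely generated torsion
`Λ`-module — for every reduction type `t`. [cite: GreenbergVatsal2000, Prop. 2.4]
[cite: Skinner2016PacificMC, §2.3 (p. 180)] [cite: JetchevSkinnerWan2017, Thm. 3.3.1 (torsion of the local terms)] -/
theorem sigmaLocal_moduleFinite_isTorsion_of_ne_zero {K : Type} [Field K] [NumberField K]
    (E : WeierstrassCurve K) [E.IsElliptic] (p : ℕ) [Fact p.Prime] (κ : ZpExtension K p)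
    (w : HeightOneSpectrum (𝓞 K)) (hw : ((p : ℕ) : 𝓞 K) ∉ w.asIdeal)
    (Nw : ℕ) (t : LocalReductionData) (c : ℤ_[p]) (hdata : IsEulerDataAt E κ w Nw t c) (hc : c ≠ 0)
    [ContinuousSMul ℤ_[p] (PrimaryTorsion (geomPoints E) p)]
    [TopologicalSpace (IwasawaAlgebra p)]
    [ContinuousSMul (IwasawaAlgebra p) (BigRepModule ℤ_[p] p (PrimaryTorsion (geomPoints E) p))] :
    Module.Finite (IwasawaAlgebra p) (CharacterModule (continuousCohomology 1
        ((AnticyclotomicBigGaloisRep κ (E.primaryTorsionGaloisRep p)).restrict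
          (localMap K (Sum.inl w))).toTopRep)) ∧
      Module.IsTorsion (IwasawaAlgebra p) (CharacterModule (continuousCohomology 1
        ((AnticyclotomicBigGaloisRep κ (E.primaryTorsionGaloisRep p)).restrict
          (localMap K (Sum.inl w))).toTopRep)) := by
  obtain ⟨-, ⟨φ, hφ, hκφ⟩, -⟩ := hdata
  haveI := moduleFinite_characterModule_h1_absInertia_primaryTorsion E p w hw
  obtain ⟨Lt, hLt⟩ := BigRepModule.exists_quotientTorsion_endo_dual
    (conjMap (((E.primaryTorsionGaloisRep p).restrict (localMap K (Sum.inl w)) :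
      ContinuousRep (absoluteGaloisGroup (w.adicCompletion K)) ℤ_[p]
        (PrimaryTorsion (geomPoints E) p))).toTopRep (absInertia (w.adicCompletion K)) φ 1).hom.toLinearMap
  obtain ⟨hfg, htors, -⟩ := sigmaLocal_dual_of_ne_zero E p κ w hw hφ hκφ hc Lt hLt
  exact ⟨hfg, htors⟩

end Literature.NumberTheory.EllipticCurves.JetchevSkinnerWan2017

end
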